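import Mathlib.RingTheory.MvPolynomial.Homogeneous
import Mathlib.Data.ENat.Lattice
import Literature.Computability.AlgebraicComplexity.CircuitDepth
import HarnessLib

/-!
# Homogeneous arithmetic circuits and homogeneous bounded-product-depth size

Topic `Literature/Computability/AlgebraicComplexity` (definition item
`defn-homProductDepthCircuitSize`, route `ValiantsHypothesis/Depth4`, item
`stmt-ValiantsHypothesis-0330`); extension of `CircuitDepth.lean`.

A (syntactically) **homogeneous** arithmetic circuit is one in which *every gate computes a
homogeneous polynomial* (Kumar–Saraf 2017, §1; Tavenas 2015, §2; Limaye–Srinivasan–Tavenas 2021,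
§2). Homogeneous circuits of product-depth `2`, unbounded fan-in, size = number of gates, are the
OUTPUT model of Tavenas' depth reduction (which produces genuine `ΣΠΣΠ` circuits, a subclass).

**AUDIT (provefact `DepthReductionChasm`, 2026-08-14).** Earlier versions of this docstring (and
users downstream) identified "product-depth `2`" with the homogeneous `ΣΠΣΠ` (depth-4) circuits
of the lower bounds of Gupta–Kamath–Kayal–Saptharishi, Kayal–Limaye–Saha–Srinivasan and
Kumar–Saraf. That identification is WRONG in the direction that matters for lower bounds:
`ArithCircuit.productDepth` counts product gates on a path and puts no constraint on sum gates,
so a product-depth-2 circuit may have sum gates BELOW its bottom products — products of linear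
forms, i.e. homogeneous `ΣΠΣΠΣ` = depth-5 circuits
(`ArithCircuit.exists_productDepth_two_not_isDepthFour` in `HomogeneousDepthFour.lean`), whereas
Kumar–Saraf's `ΣΠΣΠ` circuits are "of depth 4 with … the second and the bottom layer hav[ing]
only product gates" (§3), bottom products over leaves. Consequently `homProductDepthCircuitSize 2`
is the right measure for UPPER bounds (Tavenas; every depth-4 circuit has product-depth `≤ 2`,
`homProductDepthCircuitSize_two_le_homDepthFourCircuitSize`) but LOWER-bound statements of the
depth-4 literature must be vendored over the depth-4 measure `homDepthFourCircuitSize`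
(`HomogeneousDepthFour.lean`, discipline `ArithCircuit.IsDepthFour`); stated over the present
measure they become claims about homogeneous depth-5 circuits, for which `n^{Ω(√n)}` bounds are
open (Kumar–Saptharishi 2017; Amireddy–Garg–Kayal–Saha–Thankey 2023, Open Problem 1.2). The
definitions below are unchanged.

* `ArithCircuit.IsHomogeneousCircuit P` — every entry of `gateValues P.gates` (the polynomial
  computed at each gate, `ArithCircuit.lean`) is homogeneous of some degree.
* `homProductDepthCircuitSize Δ f : ℕ∞` — the least number of gates of a homogeneous circuit of
  product-depth `≤ Δ` computing `f` (`⊤` if there is none, e.g. `f` inhomogeneous, or `Δ = 0` and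
  `deg f ≥ 2`), the homogeneous analogue of `productDepthCircuitSize` (`CircuitDepth.lean`).
* API (real proofs): `productDepthCircuitSize_le_homProductDepthCircuitSize` (dropping
  homogeneity only helps), `homProductDepthCircuitSize_le` (attained by admissible circuits),
  `IsHomogeneousCircuit.isHomogeneous_eval` (a homogeneous circuit computes a homogeneous
  polynomial), hence `homProductDepthCircuitSize_eq_top` for inhomogeneous `f`; gateless circuits
  are homogeneous, so `homProductDepthCircuitSize Δ (X i) = 0` and `… (C c) = 0` (non-vacuity).
* Named fact (statement, D-0014): `homProductDepthCircuitSize_ne_top` — for homogeneous `f` and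
  `Δ ≥ 1` a homogeneous `ΣΠ` circuit exists (one product gate per monomial, all of degree
  `deg f`, and one sum gate), so the measure is finite; the inhomogeneous-model analogue
  `productDepthCircuitSize_ne_top` is likewise a named fact of `CircuitDepth.lean`.

## Design choices

* Homogeneity is the *semantic* per-gate condition of the sources (each gate's value is
  homogeneous), read off the library's total left-fold semantics `gateValues`; junk references
  evaluate to `0`, which is homogeneous, so ill-formed circuits get no unfair advantage beyond what
  `productDepthCircuitSize` already allows (both measures range over the same raw circuits).
* Valued in `ℕ∞` with `⨅` exactly like `productDepthCircuitSize`, so the two are comparable by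
  `iInf` monotonicity and no junk `sInf ∅ = 0` arises.
* Mathlib: `MvPolynomial.IsHomogeneous` (with `isHomogeneous_X/_C/_zero`); no circuits.

## References

* M. Kumar, S. Saraf, *On the power of homogeneous depth 4 arithmetic circuits*, SIAM J. Comput.
  46 (2017) 336–387, §1, §3 (model).
* M. Kumar, R. Saptharishi, *An exponential lower bound for homogeneous depth-5 circuits over
  finite fields*, CCC 2017, Thm. 1, §1 (audit).
* P. Amireddy, A. Garg, N. Kayal, C. Saha, B. Thankey, *Low-depth arithmetic circuit lower
  bounds: bypassing set-multilinearization*, ICALP 2023, Open Problem 1.2 (audit).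
* S. Tavenas, *Improved bounds for reduction to depth 4 and depth 3*, Inform. Comput. 240 (2015)
  2–11, §2.
* N. Limaye, S. Srinivasan, S. Tavenas, *Superpolynomial lower bounds against low-depth algebraic
  circuits*, FOCS 2021, §2.
-/

noncomputable section

open MvPolynomial

namespace Literature.Computability.AlgebraicComplexity

universe u v

namespace ArithCircuit

variable {k : Type u} {σ : Type v} [CommSemiring k]

/-- A circuit is (syntactically) **homogeneous** if every gate computes a homogeneous
polynomial: each entry of the list `gateValues P.gates` of gate values is `IsHomogeneous` of some
degree (Kumar–Saraf 2017, §1: "the polynomial computed at every gate is homogeneous";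
Tavenas 2015, §2). Inputs `X i`, constants `C c` and junk references (value `0`) are homogeneous
automatically. [cite: KumarSaraf2017, §1] -/
def IsHomogeneousCircuit (P : ArithCircuit k σ) : Prop :=
  ∀ g ∈ gateValues P.gates, ∃ e : ℕ, g.IsHomogeneous e

/-- A circuit without gates is homogeneous (vacuously). [cite: KumarSaraf2017, §1] -/
theorem isHomogeneousCircuit_of_gates_eq_nil {P : ArithCircuit k σ} (h : P.gates = []) :
    P.IsHomogeneousCircuit := by
  intro g hg
  rw [h] at hg
  simp [gateValues] at hg

/-- The input circuit `ofVar i` is homogeneous. [cite: KumarSaraf2017, §1] -/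
theorem isHomogeneousCircuit_ofVar (i : σ) : (ofVar i : ArithCircuit k σ).IsHomogeneousCircuit :=
  isHomogeneousCircuit_of_gates_eq_nil rfl

/-- The constant circuit `ofConst c` is homogeneous. [cite: KumarSaraf2017, §1] -/
theorem isHomogeneousCircuit_ofConst (c : k) :
    (ofConst c : ArithCircuit k σ).IsHomogeneousCircuit :=
  isHomogeneousCircuit_of_gates_eq_nil rfl

/-- Every operand of a homogeneous circuit evaluates to a homogeneous polynomial (variables and
constants are homogeneous, gate references are gate values or the junk value `0`).
[cite: KumarSaraf2017, §1] -/
theorem IsHomogeneousCircuit.isHomogeneous_operandEval {P : ArithCircuit k σ}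
    (h : P.IsHomogeneousCircuit) (u : Operand k σ) :
    ∃ e : ℕ, (u.eval (gateValues P.gates)).IsHomogeneous e := by
  cases u with
  | var i => exact ⟨1, isHomogeneous_X k i⟩
  | const c => exact ⟨0, isHomogeneous_C σ c⟩
  | gate j =>
    simp only [Operand.eval]
    rw [List.getD_eq_getElem?_getD]
    cases hj : (gateValues P.gates)[j]? with
    | none => exact ⟨0, by simpa using isHomogeneous_zero σ k 0⟩
    | some g => exact h g (List.mem_of_getElem? hj)

/-- **A homogeneous circuit computes a homogeneous polynomial.** [cite: KumarSaraf2017, §1] -/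
theorem IsHomogeneousCircuit.isHomogeneous_eval {P : ArithCircuit k σ}
    (h : P.IsHomogeneousCircuit) : ∃ e : ℕ, P.eval.IsHomogeneous e :=
  h.isHomogeneous_operandEval P.output

end ArithCircuit

section Measures

variable {k : Type u} {σ : Type v} [CommSemiring k]

/-- The **homogeneous product-depth-`Δ` circuit size** of `f`: the least number of gates of a
homogeneous (every gate homogeneous), unbounded fan-in arithmetic circuit of product-depth at
most `Δ` computing `f`; valued in `ℕ∞`, `⊤` when no such circuit exists (e.g. `f` not
homogeneous, `homProductDepthCircuitSize_eq_top`). For `Δ = 2` the admissible circuits are the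
homogeneous `ΣΠΣΠΣ` (depth-5) circuits — product-depth constrains product gates only, so sums
of variables may feed the bottom products; the homogeneous `ΣΠΣΠ` (depth-4) circuits of Tavenas'
output and of the Kayal–Limaye–Saha–Srinivasan / Kumar–Saraf lower bounds form the SUBCLASS
measured by `homDepthFourCircuitSize` (`HomogeneousDepthFour.lean`; AUDIT in the module
docstring), with `homProductDepthCircuitSize 2 ≤ homDepthFourCircuitSize`.
[cite: KumarSaraf2017, §1] -/
def homProductDepthCircuitSize (Δ : ℕ) (f : MvPolynomial σ k) : ℕ∞ :=
  ⨅ (P : ArithCircuit k σ) (_ : P.Computes f ∧ P.productDepth ≤ Δ ∧ P.IsHomogeneousCircuit),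
    (P.size : ℕ∞)

/-- The infimum defining `homProductDepthCircuitSize` is attained by every admissible circuit.
[cite: KumarSaraf2017, §1] -/
theorem homProductDepthCircuitSize_le {Δ : ℕ} {f : MvPolynomial σ k} {P : ArithCircuit k σ}
    (hf : P.Computes f) (hΔ : P.productDepth ≤ Δ) (hh : P.IsHomogeneousCircuit) :
    homProductDepthCircuitSize Δ f ≤ P.size :=
  iInf₂_le P ⟨hf, hΔ, hh⟩

/-- Homogeneity is a restriction: the general product-depth-`Δ` size is at most the homogeneous
one. [cite: KumarSaraf2017, §1] -/
theorem productDepthCircuitSize_le_homProductDepthCircuitSize (Δ : ℕ) (f : MvPolynomial σ k) :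
    productDepthCircuitSize Δ f ≤ homProductDepthCircuitSize Δ f :=
  le_iInf₂ fun _ hP => productDepthCircuitSize_le hP.1 hP.2.1

/-- Both size measures are monotone (antitone) in the allowed product-depth: more depth never
costs. [cite: LimayeSrinivasanTavenas2021, §2] -/
theorem homProductDepthCircuitSize_anti {Δ Δ' : ℕ} (h : Δ ≤ Δ') (f : MvPolynomial σ k) :
    homProductDepthCircuitSize Δ' f ≤ homProductDepthCircuitSize Δ f :=
  le_iInf₂ fun _ hP => homProductDepthCircuitSize_le hP.1 (hP.2.1.trans h) hP.2.2

/-- An inhomogeneous polynomial has no homogeneous circuit: the measure is `⊤`.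
[cite: KumarSaraf2017, §1] -/
theorem homProductDepthCircuitSize_eq_top {Δ : ℕ} {f : MvPolynomial σ k}
    (hf : ∀ e : ℕ, ¬ f.IsHomogeneous e) : homProductDepthCircuitSize Δ f = ⊤ := by
  refine iInf_eq_top.2 fun P => iInf_eq_top.2 fun hP => ?_
  obtain ⟨e, he⟩ := hP.2.2.isHomogeneous_eval
  exact absurd (hP.1 ▸ he) (hf e)

/-- Non-vacuity: a variable has homogeneous size `0` at every product-depth (the gateless circuit
`ofVar i`). [cite: KumarSaraf2017, §1] -/
@[simp] theorem homProductDepthCircuitSize_X (Δ : ℕ) (i : σ) :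
    homProductDepthCircuitSize Δ (X i : MvPolynomial σ k) = 0 :=
  nonpos_iff_eq_zero.1 (homProductDepthCircuitSize_le (P := ArithCircuit.ofVar i) rfl
    (Nat.zero_le _) (ArithCircuit.isHomogeneousCircuit_ofVar i))

/-- Non-vacuity: a constant has homogeneous size `0` at every product-depth (the gateless circuit
`ofConst c`). [cite: KumarSaraf2017, §1] -/
@[simp] theorem homProductDepthCircuitSize_C (Δ : ℕ) (c : k) :
    homProductDepthCircuitSize Δ (C c : MvPolynomial σ k) = 0 :=
  nonpos_iff_eq_zero.1 (homProductDepthCircuitSize_le (P := ArithCircuit.ofConst c) rfl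
    (Nat.zero_le _) (ArithCircuit.isHomogeneousCircuit_ofConst c))

/-- **Finiteness for homogeneous polynomials** (statement; D-0014). For `Δ ≥ 1` every homogeneous
`f` has a homogeneous `ΣΠ` circuit — one product gate per monomial of the support (each of degree
`deg f`) and one weighted-sum gate on top — so `homProductDepthCircuitSize Δ f < ⊤`. The general
(inhomogeneous) analogue is the named fact `productDepthCircuitSize_ne_top` of `CircuitDepth.lean`.
[cite: LimayeSrinivasanTavenas2021, §2] -/
def homProductDepthCircuitSize_ne_top : Prop :=
  ∀ {k : Type u} {σ : Type v} [CommSemiring k] {Δ : ℕ} (_ : 1 ≤ Δ) {f : MvPolynomial σ k}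
    {e : ℕ} (_ : f.IsHomogeneous e), homProductDepthCircuitSize Δ f ≠ ⊤

end Measures

end Literature.Computability.AlgebraicComplexity

end
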